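import Literature.MathematicalPhysics.QuantumFieldTheory.Balaban1983to89.B3GkZeroBoxPointwise
import HarnessLib

/-!
# Dimock, *Quantum electrodynamics on the 3-torus II*, §1.2.4 (26) + (28) ⟹ (29) and §1.3.4 (50) + (52) ⟹ (53):
# THE SUM OVER THE SCALES — the multiscale kernel sums produce the short-distance singularities `d(x,x′)^{−1}`,
# `d(x,x′)^{−2}` and keep the exponential decay — PROVED (the printed split «`L^{k−j}d(x,x′) ≤ 1` and the
# complement» is the tree's `B3GkZeroBoxPointwise.scaleSum_le` BY NAME); the per-scale decay (28) ∕ (52), which the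
# paper QUOTES from Bałaban [6] ∕ [13] ∕ [14], enters as hypotheses in its printed shape

statement-level skeleton of published theorems with citation tags; proofs where landed; nothing here is a claim about the Yang–Mills mass gap

(Writer seat p11 = literature-prover-lit-balaban-p11-g21-0; YM LIT SWEEP item (c), Lean lane — zero weight for the
YM-INPRINT tokens of row C13.)

**Citation header (reproduction of PUBLISHED work).** J. Dimock, *Quantum electrodynamics on the 3-torus II. The RG
flow*, arXiv:math-ph/0407063v1 (2004) [Dimock2004QED3TorusII]. Loci are PDF pages `p.N` and text-layer lines `Lnn` of
the held layer `paper:arxiv-math-ph_0407063` (37 pp.). The per-scale inputs are attributed by the paper to T. Bałaban,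
*Regularity and decay of lattice Green's functions*, CMP **89** (1983) 571–597 (= its [6]) and to Bałaban–O'Carroll–Schor,
CMP **122** (1989) 233–247 (= [13], [BalabanOcarrollSchor1989]) ∕ J. Math. Phys. **32** (1991) 3199–3208 (= [14], NOT HELD) —
they are NOT proved here (see «What is NOT claimed»).

**What the paper prints (verbatim, text layer).**
* §1.2.4 p.6 L33–50: *"As an operator on functions on `T^{−k}_{N+M−k}`, the propagator `G_k` has a kernel `G_k(x,x′)` defined
  so that `(G_kf)(x) = ∫G_k(x,x′)f(x′)dx′` where again the integral means the weighted sum. Since `σ^T_{L^{−1}} = L^{−2}σ_L`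
  for bosons and `(σ^{−1}_LG_kσ_L)(x,x′) = L³G_k(Lx,Lx′)` … we can write (23) as `G_{k+1}(x,x′) = L(G_k(Lx,Lx′) +
  (H_kC_kH_k^T)(Lx,Lx′))` (25). If we iterate this we find `G_k(x,x′) = Σ_{j=0}^{k−1} L^{k−j}C̃_j(L^{k−j}x, L^{k−j}x′)` (26)
  where `C̃_j = H_jC_jH_j^T` (27)"*.
* p.6 L51–59, (28): *"The operators `H_j, C_j, C̃_j` have kernels which satisfy … `|H_j(x,y)|, |∂H_j(x,y)| ≤ O(1)exp(−O(1)d(x,y))`,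
  `|C_j(y,y′)| ≤ O(1)exp(−O(1)d(y,y′))`, `|C̃_j(x,x′)| ≤ O(1)exp(−O(1)d(x,x′))` (28). These are proved by Balaban in [6], but
  one may prefer to use the methods of [13]."*
* p.6 L60–75, (29): *"Using this in (26) leads to the estimates `|G_k(x,x′)| ≤ O(1)d(x,x′)^{−1}e^{−O(1)d(x,x′)}` (`x ≠ x′`),
  `O(L^k)` (`x = x′`); `|∂G_k(x,x′)| ≤ O(1)d(x,x′)^{−2}e^{−O(1)d(x,x′)}` (`x ≠ x′`), `O(L^{2k})` (`x = x′`) (29). (To see the short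
  distance bound divide the sum into terms satisfying `L^{k−j}d(x,x′) ≤ 1` and the complement.) The function `G_k(x,x′)` is our
  basic photon propagator after `k` steps. This estimate shows the exponential decay … and the characteristic short distant
  singularity `d(x,x′)^{−1}`."*  Footnote 1, p.6 L76–77: *"In our notation `O(1)` allows `L` dependence."*
* §1.3.4 p.9 L32–42: *"For the kernels we can rewrite (47) as `S_{k+1}(A,x,x′) = L²(S_k(A_L,Lx,Lx′) + (H_k(A_L)Γ_k(A_L)H_k(A_L)^T)
  (Lx,Lx′))` (49). Here we have used `(σ^{−1}_L)^T = L^{−1}σ_L` for fermions. Iterating this yields `S_k(A,x,x′) =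
  Σ_{j=0}^{k−1} L^{2(k−j)}Γ̃_j(A_{L^{k−j}}; L^{k−j}x, L^{k−j}x′)` (50) where `Γ̃_j(A) = H_j(A)Γ_j(A)H_j(A)^T` (51) provided all the
  operators exist."*
* p.9 L43–60, (52)–(53): *"Balaban, O'Carroll, and Schor show for `A` on `T^{−k}_{N+M−k}` that if `e_k|∂A|` is sufficiently small
  then `S_k(A), H_k(A), Γ_k(A)` all exist and `|H_k(A,x,y)| ≤ O(1)exp(−O(1)d(x,y))`, `|Γ_k(A,y,y′)| ≤ O(1)exp(−O(1)d(y,y′))`,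
  `|Γ̃_k(A,x,x′)| ≤ O(1)exp(−O(1)d(x,x′))` (52). For `A = 0` this can be found in [13]. For `A ≠ 0` it is a special case of
  results in [14] and section 3. If `A` on `T^{−k}_{N+M−k}` has `e_k|∂A|` sufficiently small, then `e_j|∂A_{L^{k−j}}|` on
  `T^{−j}_{N+M−j}` is even smaller by a factor of `L^{−3(k−j)/2}` so we can use (50) to obtain the bound `|S_k(A,x,x′)| ≤
  O(1)d(x,x′)^{−2}e^{−O(1)d(x,x′)}` (`x ≠ x′`), `O(L^{2k})` (`x = x′`) (53). The function `S_k(A,x,x′)` is our basic fermion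
  propagator with background field `A`. The estimate shows the characteristic short distant singularity `d(x,x′)^{−2}`."*

**The reading used (declared): INDEX COORDINATES.** p.3 L13–16: `T^{−N}_M = L^{−N}ℤ³∕L^Mℤ³`; every torus
`T^{−j}_{N+M−j}` (`0 ≤ j ≤ k`) of the paper has spacing `L^{−j}` and period `L^{N+M−j}`, hence the SAME site set
`I = (ℤ∕L^{N+M}ℤ)³` (site `L^{−j}·i`), on which the distance at scale `j` is `d_j(i,i′) = ρ(i,i′)∕L^j` for one index distance
`ρ ≥ 0` (`ρ(i,i′) ≥ 1` for `i ≠ i′`).  Dimock's rescaling `x ↦ L^{k−j}x : T^{−k}_{N+M−k} → T^{−j}_{N+M−j}` is the IDENTITY on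
site indices and multiplies distances by `L^{k−j}`: `d_j(L^{k−j}x, L^{k−j}x′) = L^{k−j}d_k(x,x′)` (`pow_sub_mul_div_pow`).  In these
coordinates (26) reads `G_k(i,i′) = Σ_{j<k} L^{k−j}·C̃_j(i,i′)`, (50) reads `S_k(i,i′) = Σ_{j<k} L^{2(k−j)}·Γ̃_j(i,i′)`, and the
forward difference quotient of `T^{−k}` is `(∂^{(k)}f)(i) = L^k(f(s i) − f(i))` for the unit shift `s` of the index lattice, so
that `∂^{(k)}[C̃_j] = L^{k−j}·∂^{(j)}[C̃_j]` — whence `∂G_k = Σ_{j<k} L^{2(k−j)}(∂^{(j)}C̃_j)` (`dimock29_deriv_identity`, pure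
algebra).  Everything below is stated for an ARBITRARY index type `I`, index distance `ρ : I → I → ℝ` and shift
`s : I → I`, and kernels with values in any real (semi)normed space `E` (`ℝ` for the photon kernels, `ℂ` ∕ spinor matrices
for the fermion kernels); the concrete torus is an instance.

**What is reproduced here (kernel-checked, zero `sorry`, no definitions, no named facts; imports = the tree file
`B3GkZeroBoxPointwise` (for `scaleSum_le`) + `HarnessLib`).**
* §1 (pure real analysis) **`sum_scales_le`**: for `L > 1`, `c > 0`, `p ≥ 1`, every `k` and every `d > 0`,
  `Σ_{j<k} L^{p(k−j)} e^{−cL^{k−j}d} ≤ K(L,c,p)·d^{−p}·e^{−(c∕2)Ld}` with the EXPLICIT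
  `K(L,c,p) = (L∕(L−1))e^{c∕2} + p!(c∕2)^{−p}(1 − e^{−(c∕2)(L−1)})^{−1}` (`scaleConst_pos`: `K > 0`) — obtained from p39 g5's
  `B3GkZeroBoxPointwise.scaleSum_le` (`Σ_{j<k}(L^j)^{−p}e^{−δn∕L^j} ≤ K·n^{−p}e^{−(δ∕2)n∕L^{k−1}}`, whose proof IS the printed
  split at `L^j = n`, i.e. at `L^{k−j}d = 1`) with `n = L^kd`; **`sum_scales_diag_le`**: `Σ_{j<k} L^{p(k−j)} ≤
  (1 − L^{−p})^{−1}(L^k)^p` (from `scaleSum_zero_le`); and the normed-space forms **`norm_sum_scales_smul_le`** ∕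
  **`norm_sum_scales_smul_diag_le`**: pieces `g_j ∈ E` with `‖g_j‖ ≤ Ce^{−cL^{k−j}d}` (resp. `≤ C`) give
  `‖Σ_{j<k} L^{p(k−j)}•g_j‖ ≤ C·K·d^{−p}e^{−(c∕2)Ld}` (resp. `≤ C(1 − L^{−p})^{−1}L^{pk}`).
* §2 (the printed statements, index coordinates) **`dimock29_value`** ∕ **`dimock29_value_diag`**: (26) with (28) for `C̃_j`
  (`‖C̃_j(i,i′)‖ ≤ Ce^{−c·d_j(i,i′)}`) ⟹ `‖G_k(i,i′)‖ ≤ C·K(L,c,1)·d_k(i,i′)^{−1}e^{−(c∕2)L·d_k(i,i′)}` for `ρ(i,i′) > 0` (`x ≠ x′`)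
  and `≤ C(1 − L^{−1})^{−1}L^k` everywhere (the printed `O(L^k)` at `x = x′`); **`dimock29_deriv_identity`**,
  **`dimock29_deriv`** ∕ **`dimock29_deriv_diag`**: the derivative member of (29) — given the per-scale bound
  `‖(∂^{(j)}C̃_j)(i,i′)‖ ≤ Ce^{−c·d_j(i,i′)}` (§3 derives it from (27)–(28)), `‖(∂^{(k)}G_k)(i,i′)‖ ≤ C·K(L,c,2)·d_k^{−2}e^{−(c∕2)L·d_k}`
  off the diagonal and `≤ C(1 − L^{−2})^{−1}L^{2k}` everywhere; **`dimock53`** ∕ **`dimock53_diag`**: (50) with (52) for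
  `Γ̃_j` ⟹ `‖S_k(A;i,i′)‖ ≤ C·K(L,c,2)·d_k^{−2}e^{−(c∕2)L·d_k}` off the diagonal and `≤ C(1 − L^{−2})^{−1}L^{2k}` everywhere.
  The printed `O(1)`'s are thus `C·K(L,c,p)` and `(c∕2)L` (`≥ c∕2`): functions of `L` and of the `O(1)`'s of (28) ∕ (52) only,
  uniform in `k`, `N`, `M` and the sites — footnote 1's convention; **`dimock29_value_asPrinted`**,
  **`dimock29_deriv_asPrinted`**, **`dimock53_asPrinted`** package exactly this quantifier shape (`∃ O₁ O₂ > 0` from `L, c`;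
  then `∀ C, ρ, kernels, k, i, i′`: the off-diagonal law `C·O₁·d^{−p}e^{−O₂d}` and the diagonal law `C·O₁·L^{pk}`).
* §3 (the composite kernels (27) ∕ (51)) **`chain3_norm_le`**: in a (semi)normed ring, for kernels with
  `‖A(x,y)‖ ≤ C_Ae^{−cρ(x,y)}`, `‖B(y,y′)‖ ≤ C_Be^{−cρ(y,y′)}`, `‖D(x′,y′)‖ ≤ C_De^{−cρ(x′,y′)}` over unit-lattice points
  `y = ι(y)`, `ρ ≥ 0` symmetric with the triangle inequality, and the one-point sum `Σ_y e^{−(c∕2)ρ(u,ιy)} ≤ K₀` uniform in `u`: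
  `‖Σ_{y,y′}A(x,y)B(y,y′)D(x′,y′)‖ ≤ C_AC_BC_DK₀²e^{−(c∕2)ρ(x,x′)}` — with `A = B = H_j`-type data this is the third line of (28)
  ∕ (52) from the first two (`C̃_j = H_jC_jH_j^T`, `H^T(y′,x′) = H(x′,y′)`), and with `A = ∂H_j` (first line of (28)) it is
  the per-scale input of `dimock29_deriv`; **`smul_chain3_sub`**: `∂^{(j)}` of the chain in `x` = the chain with
  `∂^{(j)}H_j` in the first slot (finite sums; normed `ℝ`-algebra).

**HONEST SCOPE ∕ what is NOT claimed.** (i) The per-scale decay estimates (28) and (52) themselves — Bałaban's [6]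
(rows B4 of the cell; [Balaban1983RegularityDecay]) and BOS [13] §III ∕ [14] — are HYPOTHESES here, in their printed
shape; nothing of those papers is proved or restated as a fact.  (ii) The existence statements («`S_k(A), H_k(A), Γ_k(A)`
all exist», invertibility of `D#_k(A)` for small `e_k|∂A|`) and the smallness bookkeeping «`e_j|∂A_{L^{k−j}}|` … smaller by a
factor `L^{−3(k−j)∕2}`» (p.9 L50–54) are not formalized: in §2 the background fields are silent parameters of the abstract
kernels `C̃_j`, `Γ̃_j`.  (iii) The rescaling identities (25) ∕ (49) with the lattice weights and `σ_L` are not re-derived (the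
unweighted one-step algebra (23) ∕ (47) is the tree's `QuantumLattice/FermionBlockRGFluctuation.lean`); this file STARTS from
the iterated forms (26) ∕ (50) read in index coordinates.  (iv) The one-point lattice sum `K₀` of §3 is a hypothesis; on the
cell's tori it is the tree's `Dimock2011to13.RandomWalkTorusDecay.sum_exp_torusDist_le` ∕
`Balaban1983to89.B12Decay510Torus.sum_exp_pl1_le_K₁` (periodic ℓ¹ distance).  (v) `d` is any index distance (the paper's
torus distance; sup ∕ ℓ¹ ∕ Euclidean members differ by factors absorbed in the `O(1)`'s).  NOT a statement about the
ultraviolet problem in `d = 4`; NOT a claim about any Bałaban paper.  Unit `lit-balaban-p11-g21`, HOME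
`run/shared/lean/pub/lit-balaban/`, 2026-08-22.
-/

noncomputable section

open Finset Real

namespace Literature.MathematicalPhysics.QuantumFieldTheory.Dimock2011to13

namespace QED3TorusII

open Literature.MathematicalPhysics.QuantumFieldTheory.Balaban1983to89.B3GkZeroBoxPointwise
  (scaleSum_le scaleSum_zero_le)

/-! ## §1 The sum over the scales: `Σ_{j<k} L^{p(k−j)}e^{−cL^{k−j}d} ≤ K(L,c,p)·d^{−p}·e^{−(c∕2)Ld}` -/

section Scales

variable {L c : ℝ}

/-- The constant `K(L,c,p) = (L∕(L−1))e^{c∕2} + p!(c∕2)^{−p}(1 − e^{−(c∕2)(L−1)})^{−1}` of the scale sum is positive for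
`L > 1`, `c > 0` — the printed `O(1)` of (29) ∕ (53) («`O(1)` allows `L` dependence», footnote 1).
[cite: Dimock2004QED3TorusII, §1.2.4 (29) p.6 L60–77] -/
theorem scaleConst_pos (hL : 1 < L) (hc : 0 < c) (p : ℕ) :
    0 < L / (L - 1) * Real.exp (c / 2)
        + (p.factorial : ℝ) / (c / 2) ^ p * (1 - Real.exp (-(c / 2 * (L - 1))))⁻¹ := by
  have hL1 : 0 < L - 1 := by linarith
  have h1 : 0 < L / (L - 1) * Real.exp (c / 2) := by positivity
  have h2 : 0 < 1 - Real.exp (-(c / 2 * (L - 1))) := by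
    have : Real.exp (-(c / 2 * (L - 1))) < 1 := Real.exp_lt_one_iff.2 (by nlinarith)
    linarith
  have h3 : 0 ≤ (p.factorial : ℝ) / (c / 2) ^ p * (1 - Real.exp (-(c / 2 * (L - 1))))⁻¹ := by positivity
  linarith

/-- kernel: `L^{k−j} = L^k·(L^j)^{−1}` for `j ≤ k`, `L ≠ 0`. [folklore] -/
private theorem pow_sub_eq_mul_inv (hL : 0 < L) {j k : ℕ} (hjk : j ≤ k) :
    L ^ (k - j) = L ^ k * (L ^ j)⁻¹ := by
  have hLj : L ^ j ≠ 0 := pow_ne_zero _ hL.ne'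
  rw [← div_eq_mul_inv, eq_div_iff hLj, ← pow_add, Nat.sub_add_cancel hjk]

/-- **THE SUM OVER THE SCALES** (the mechanism of (29) and (53)).  For `L > 1`, `c > 0`, an exponent `p ≥ 1`, any number
of scales `k` and any distance `d > 0`:
`Σ_{j<k} L^{p(k−j)}·e^{−c·L^{k−j}d} ≤ K(L,c,p)·d^{−p}·e^{−(c∕2)·L·d}`,
`K(L,c,p) = (L∕(L−1))e^{c∕2} + p!(c∕2)^{−p}(1 − e^{−(c∕2)(L−1)})^{−1}`.  Proof = the printed *"divide the sum into terms
satisfying `L^{k−j}d(x,x′) ≤ 1` and the complement"*, which is `B3GkZeroBoxPointwise.scaleSum_le` at `n = L^kd`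
(`L^{k−j}d = n∕L^j`, `L^{p(k−j)} = (L^k)^p(L^j)^{−p}`, `n∕L^{k−1} = Ld`).
[cite: Dimock2004QED3TorusII, §1.2.4 (29) p.6 L60–71 (the parenthetical remark L70–71)] -/
theorem sum_scales_le (hL : 1 < L) (hc : 0 < c) {p : ℕ} (hp : 1 ≤ p) (k : ℕ) {d : ℝ} (hd : 0 < d) :
    ∑ j ∈ range k, L ^ (p * (k - j)) * Real.exp (-(c * (L ^ (k - j) * d)))
      ≤ (L / (L - 1) * Real.exp (c / 2)
            + (p.factorial : ℝ) / (c / 2) ^ p * (1 - Real.exp (-(c / 2 * (L - 1))))⁻¹)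
          * d⁻¹ ^ p * Real.exp (-(c / 2 * (L * d))) := by
  have hK0 := scaleConst_pos hL hc p
  have hL0 : 0 < L := by linarith
  rcases Nat.eq_zero_or_pos k with rfl | hk
  · simp only [range_zero, sum_empty]; positivity
  have hn0 : 0 < L ^ k * d := by positivity
  have hS := scaleSum_le hL hc hp k hn0
  set K := L / (L - 1) * Real.exp (c / 2)
        + (p.factorial : ℝ) / (c / 2) ^ p * (1 - Real.exp (-(c / 2 * (L - 1))))⁻¹ with hK
  set n : ℝ := L ^ k * d with hn
  -- termwise: `L^{p(k−j)}e^{−cL^{k−j}d} = (L^k)^p · [(L^j)^{−p} e^{−cn/L^j}]`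
  have hterm : ∀ j ∈ range k, L ^ (p * (k - j)) * Real.exp (-(c * (L ^ (k - j) * d)))
      = (L ^ k) ^ p * ((L ^ j)⁻¹ ^ p * Real.exp (-(c * n / L ^ j))) := by
    intro j hj
    have hjk : j ≤ k := (mem_range.1 hj).le
    have hLj : L ^ j ≠ 0 := pow_ne_zero _ hL0.ne'
    have hpow : L ^ (k - j) = L ^ k * (L ^ j)⁻¹ := pow_sub_eq_mul_inv hL0 hjk
    have h1 : L ^ (p * (k - j)) = (L ^ k) ^ p * (L ^ j)⁻¹ ^ p := by
      rw [pow_mul', hpow, mul_pow]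
    have h2 : c * (L ^ (k - j) * d) = c * n / L ^ j := by
      rw [hpow, hn]; field_simp
    rw [h1, h2, mul_assoc]
  rw [sum_congr rfl hterm, ← mul_sum]
  -- `n / L^{k−1} = L·d`
  have hnd : n / L ^ (k - 1) = L * d := by
    rw [hn, div_eq_iff (pow_ne_zero _ hL0.ne')]
    rw [show L ^ k = L * L ^ (k - 1) by rw [← pow_succ', Nat.sub_add_cancel hk]]
    ring
  rw [hnd] at hS
  -- `(L^k)^p · n^{−p} = d^{−p}`
  have hfac : (L ^ k) ^ p * n⁻¹ ^ p = d⁻¹ ^ p := by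
    rw [← mul_pow, hn, mul_inv, ← mul_assoc, mul_inv_cancel₀ (pow_ne_zero _ hL0.ne'), one_mul]
  calc (L ^ k) ^ p * ∑ j ∈ range k, (L ^ j)⁻¹ ^ p * Real.exp (-(c * n / L ^ j))
      ≤ (L ^ k) ^ p * (K * n⁻¹ ^ p * Real.exp (-(c / 2 * (L * d)))) :=
        mul_le_mul_of_nonneg_left hS (by positivity)
    _ = K * ((L ^ k) ^ p * n⁻¹ ^ p) * Real.exp (-(c / 2 * (L * d))) := by ring
    _ = K * d⁻¹ ^ p * Real.exp (-(c / 2 * (L * d))) := by rw [hfac]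

/-- **The scale sum on the diagonal** (`x = x′`, no decay available): `Σ_{j<k} L^{p(k−j)} ≤ (1 − L^{−p})^{−1}·(L^k)^p` for
`L > 1`, `p ≥ 1` — the printed `O(L^k)` (`p = 1`) ∕ `O(L^{2k})` (`p = 2`) of (29) and (53) at `x = x′`
(`B3GkZeroBoxPointwise.scaleSum_zero_le`). [cite: Dimock2004QED3TorusII, §1.2.4 (29) p.6 L60–69 and §1.3.4 (53) p.9 L54–58] -/
theorem sum_scales_diag_le (hL : 1 < L) {p : ℕ} (hp : 1 ≤ p) (k : ℕ) :
    ∑ j ∈ range k, L ^ (p * (k - j)) ≤ (1 - (L ^ p)⁻¹)⁻¹ * (L ^ k) ^ p := by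
  have hL0 : 0 < L := by linarith
  have hterm : ∀ j ∈ range k, L ^ (p * (k - j)) = (L ^ k) ^ p * (L ^ j)⁻¹ ^ p := by
    intro j hj
    rw [pow_mul', pow_sub_eq_mul_inv hL0 (mem_range.1 hj).le, mul_pow]
  rw [sum_congr rfl hterm, ← mul_sum]
  have h := scaleSum_zero_le hL hp k
  calc (L ^ k) ^ p * ∑ j ∈ range k, (L ^ j)⁻¹ ^ p ≤ (L ^ k) ^ p * (1 - (L ^ p)⁻¹)⁻¹ :=
        mul_le_mul_of_nonneg_left h (by positivity)
    _ = _ := mul_comm _ _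

variable {E : Type*} [SeminormedAddCommGroup E] [NormedSpace ℝ E]

/-- **The scale sum for normed-space valued pieces** (kernel values in `ℝ`, `ℂ`, spinor matrices …): if
`‖g_j‖ ≤ C·e^{−c·L^{k−j}d}` for `j < k` (`C ≥ 0`, `d > 0`), then
`‖Σ_{j<k} L^{p(k−j)}•g_j‖ ≤ C·K(L,c,p)·d^{−p}·e^{−(c∕2)Ld}`. [cite: Dimock2004QED3TorusII, §1.2.4 (26)–(29) p.6 L46–71] -/
theorem norm_sum_scales_smul_le (hL : 1 < L) (hc : 0 < c) {p : ℕ} (hp : 1 ≤ p) (k : ℕ) {d C : ℝ}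
    (hd : 0 < d) (hC : 0 ≤ C) (g : ℕ → E)
    (hg : ∀ j < k, ‖g j‖ ≤ C * Real.exp (-(c * (L ^ (k - j) * d)))) :
    ‖∑ j ∈ range k, (L ^ (p * (k - j))) • g j‖
      ≤ C * (L / (L - 1) * Real.exp (c / 2)
            + (p.factorial : ℝ) / (c / 2) ^ p * (1 - Real.exp (-(c / 2 * (L - 1))))⁻¹)
          * d⁻¹ ^ p * Real.exp (-(c / 2 * (L * d))) := by
  have hL0 : 0 < L := by linarith
  calc ‖∑ j ∈ range k, (L ^ (p * (k - j))) • g j‖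
      ≤ ∑ j ∈ range k, ‖(L ^ (p * (k - j))) • g j‖ := norm_sum_le _ _
    _ ≤ ∑ j ∈ range k, L ^ (p * (k - j)) * (C * Real.exp (-(c * (L ^ (k - j) * d)))) := by
        refine sum_le_sum fun j hj => ?_
        rw [norm_smul, Real.norm_of_nonneg (by positivity)]
        exact mul_le_mul_of_nonneg_left (hg j (mem_range.1 hj)) (by positivity)
    _ = C * ∑ j ∈ range k, L ^ (p * (k - j)) * Real.exp (-(c * (L ^ (k - j) * d))) := by
        rw [mul_sum]; exact sum_congr rfl fun j _ => by ring
    _ ≤ C * ((L / (L - 1) * Real.exp (c / 2)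
            + (p.factorial : ℝ) / (c / 2) ^ p * (1 - Real.exp (-(c / 2 * (L - 1))))⁻¹)
          * d⁻¹ ^ p * Real.exp (-(c / 2 * (L * d)))) :=
        mul_le_mul_of_nonneg_left (sum_scales_le hL hc hp k hd) hC
    _ = _ := by ring

/-- **The diagonal form for normed-space valued pieces**: `‖g_j‖ ≤ C` for `j < k` gives
`‖Σ_{j<k} L^{p(k−j)}•g_j‖ ≤ C·(1 − L^{−p})^{−1}·(L^k)^p`. [cite: Dimock2004QED3TorusII, §1.2.4 (29) p.6 L60–69 (the `x = x′` members)] -/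
theorem norm_sum_scales_smul_diag_le (hL : 1 < L) {p : ℕ} (hp : 1 ≤ p) (k : ℕ) {C : ℝ}
    (hC : 0 ≤ C) (g : ℕ → E) (hg : ∀ j < k, ‖g j‖ ≤ C) :
    ‖∑ j ∈ range k, (L ^ (p * (k - j))) • g j‖ ≤ C * (1 - (L ^ p)⁻¹)⁻¹ * (L ^ k) ^ p := by
  have hL0 : 0 < L := by linarith
  calc ‖∑ j ∈ range k, (L ^ (p * (k - j))) • g j‖
      ≤ ∑ j ∈ range k, ‖(L ^ (p * (k - j))) • g j‖ := norm_sum_le _ _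
    _ ≤ ∑ j ∈ range k, L ^ (p * (k - j)) * C := by
        refine sum_le_sum fun j hj => ?_
        rw [norm_smul, Real.norm_of_nonneg (by positivity)]
        exact mul_le_mul_of_nonneg_left (hg j (mem_range.1 hj)) (by positivity)
    _ = C * ∑ j ∈ range k, L ^ (p * (k - j)) := by rw [mul_sum]; exact sum_congr rfl fun j _ => by ring
    _ ≤ C * ((1 - (L ^ p)⁻¹)⁻¹ * (L ^ k) ^ p) :=
        mul_le_mul_of_nonneg_left (sum_scales_diag_le hL hp k) hC
    _ = _ := by ring

end Scales

/-! ## §2 Dimock's (26) + (28) ⟹ (29) and (50) + (52) ⟹ (53), in index coordinates -/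

section Dimock

variable {L c C : ℝ}
variable {E : Type*} [SeminormedAddCommGroup E] [NormedSpace ℝ E]
variable {I : Type*}

/-- **The rescaling of distances**: for `j ≤ k`, `L^{k−j}·(ρ∕L^k) = ρ∕L^j` — two sites at index distance `ρ` are at
distance `d_k = ρ∕L^k` on `T^{−k}_{N+M−k}` and at distance `d_j = L^{k−j}d_k` on `T^{−j}_{N+M−j}`, i.e. Dimock's map
`x ↦ L^{k−j}x` multiplies distances by `L^{k−j}` (the arguments `L^{k−j}x, L^{k−j}x′` of (26) ∕ (50)).
[cite: Dimock2004QED3TorusII, §1.2.4 (26) p.6 L46–47 and §1.3.4 (50) p.9 L36–39] -/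
theorem pow_sub_mul_div_pow (hL : 0 < L) {j k : ℕ} (hjk : j ≤ k) (ρ : ℝ) :
    L ^ (k - j) * (ρ / L ^ k) = ρ / L ^ j := by
  rw [pow_sub_eq_mul_inv hL hjk]
  field_simp

/-- **(26) + (28) ⟹ (29), the value of the photon propagator off the diagonal.**  Sites `i, i′` of the common index set,
index distance `ρ(i,i′) > 0` (`x ≠ x′`); per-scale kernels `C̃_j` with (28) on their own lattice,
`‖C̃_j(i,i′)‖ ≤ C·e^{−c·ρ(i,i′)∕L^j}` (`j < k`); `G_k(i,i′) = Σ_{j<k} L^{k−j}•C̃_j(i,i′)` (26).  Then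
`‖G_k(i,i′)‖ ≤ C·K(L,c,1)·(ρ(i,i′)∕L^k)^{−1}·e^{−(c∕2)L·ρ(i,i′)∕L^k}` — the printed
`|G_k(x,x′)| ≤ O(1)d(x,x′)^{−1}e^{−O(1)d(x,x′)}`, `d(x,x′) = ρ(i,i′)∕L^k`, constants uniform in `k`, `N`, `M`.
[cite: Dimock2004QED3TorusII, §1.2.4 (26)–(29) p.6 L46–75] -/
theorem dimock29_value (hL : 1 < L) (hc : 0 < c) (hC : 0 ≤ C) (ρ : I → I → ℝ) (Ct : ℕ → I → I → E)
    (k : ℕ) (h28 : ∀ j < k, ∀ i i', ‖Ct j i i'‖ ≤ C * Real.exp (-(c * (ρ i i' / L ^ j))))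
    {i i' : I} (hρ : 0 < ρ i i') :
    ‖∑ j ∈ range k, (L ^ (k - j)) • Ct j i i'‖
      ≤ C * (L / (L - 1) * Real.exp (c / 2)
            + (Nat.factorial 1 : ℝ) / (c / 2) ^ 1 * (1 - Real.exp (-(c / 2 * (L - 1))))⁻¹)
          * (ρ i i' / L ^ k)⁻¹ ^ 1 * Real.exp (-(c / 2 * (L * (ρ i i' / L ^ k)))) := by
  have hL0 : 0 < L := by linarith
  have hd : 0 < ρ i i' / L ^ k := by positivity
  have h := norm_sum_scales_smul_le (E := E) hL hc (le_refl 1) k hd hC (fun j => Ct j i i') ?_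
  · simpa only [one_mul] using h
  · intro j hj
    rw [pow_sub_mul_div_pow hL0 hj.le]
    exact h28 j hj i i'

/-- **(26) + (28) ⟹ (29), the value of the photon propagator everywhere (the diagonal member).**  With (28) for `C̃_j`
and `ρ ≥ 0`: `‖G_k(i,i′)‖ ≤ C·(1 − L^{−1})^{−1}·L^k` for ALL `i, i′` — the printed `O(L^k)` at `x = x′`.
[cite: Dimock2004QED3TorusII, §1.2.4 (29) p.6 L60–69] -/
theorem dimock29_value_diag (hL : 1 < L) (hc : 0 < c) (hC : 0 ≤ C) (ρ : I → I → ℝ)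
    (hρ0 : ∀ i i', 0 ≤ ρ i i') (Ct : ℕ → I → I → E)
    (k : ℕ) (h28 : ∀ j < k, ∀ i i', ‖Ct j i i'‖ ≤ C * Real.exp (-(c * (ρ i i' / L ^ j)))) (i i' : I) :
    ‖∑ j ∈ range k, (L ^ (k - j)) • Ct j i i'‖ ≤ C * (1 - (L ^ 1)⁻¹)⁻¹ * (L ^ k) ^ 1 := by
  have hL0 : 0 < L := by linarith
  have h := norm_sum_scales_smul_diag_le (E := E) hL (le_refl 1) k hC (fun j => Ct j i i') ?_
  · simpa only [one_mul] using h
  · intro j hj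
    refine (h28 j hj i i').trans ?_
    have : Real.exp (-(c * (ρ i i' / L ^ j))) ≤ 1 := Real.exp_le_one_iff.2 (by
      have := hρ0 i i'; have : 0 ≤ c * (ρ i i' / L ^ j) := by positivity
      linarith)
    nlinarith

/-- **The derivative of (26): `∂^{(k)}G_k = Σ_{j<k} L^{2(k−j)}·(∂^{(j)}C̃_j)`** — the forward difference quotient of
`T^{−k}` along the index shift `s`, `(∂^{(k)}f)(i) = L^k(f(s i) − f(i))`, applied to `G_k(·,i′) = Σ_j L^{k−j}C̃_j(·,i′)`, equals
the scale sum with weights `L^{2(k−j)}` of the `T^{−j}` difference quotients `∂^{(j)}C̃_j = L^j(C̃_j(s·,i′) − C̃_j(·,i′))`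
(chain rule under `x ↦ L^{k−j}x`; pure algebra, any `L`). [cite: Dimock2004QED3TorusII, §1.2.4 (26), (29) p.6 L46–69] -/
theorem dimock29_deriv_identity (L : ℝ) (s : I → I) (Ct : ℕ → I → I → E) (k : ℕ) (i i' : I) :
    (L ^ k) • (∑ j ∈ range k, (L ^ (k - j)) • Ct j (s i) i' - ∑ j ∈ range k, (L ^ (k - j)) • Ct j i i')
      = ∑ j ∈ range k, (L ^ (2 * (k - j))) • ((L ^ j) • (Ct j (s i) i' - Ct j i i')) := by
  rw [← sum_sub_distrib, smul_sum]
  refine sum_congr rfl fun j hj => ?_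
  have hjk : j < k := mem_range.1 hj
  rw [← smul_sub, smul_smul, smul_smul, ← pow_add, ← pow_add]
  congr 2
  omega

/-- **(26) + (28) ⟹ (29), the derivative of the photon propagator off the diagonal.**  Given the per-scale bound
`‖(∂^{(j)}C̃_j)(i,i′)‖ ≤ C·e^{−c·ρ(i,i′)∕L^j}` (`j < k`; from (27)–(28) by §3) and `ρ(i,i′) > 0`:
`‖(∂^{(k)}G_k)(i,i′)‖ ≤ C·K(L,c,2)·(ρ(i,i′)∕L^k)^{−2}·e^{−(c∕2)L·ρ(i,i′)∕L^k}` — the printed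
`|∂G_k(x,x′)| ≤ O(1)d(x,x′)^{−2}e^{−O(1)d(x,x′)}`. [cite: Dimock2004QED3TorusII, §1.2.4 (29) p.6 L60–71] -/
theorem dimock29_deriv (hL : 1 < L) (hc : 0 < c) (hC : 0 ≤ C) (ρ : I → I → ℝ) (s : I → I)
    (Ct : ℕ → I → I → E) (k : ℕ)
    (h28d : ∀ j < k, ∀ i i', ‖(L ^ j) • (Ct j (s i) i' - Ct j i i')‖ ≤ C * Real.exp (-(c * (ρ i i' / L ^ j))))
    {i i' : I} (hρ : 0 < ρ i i') :
    ‖(L ^ k) • (∑ j ∈ range k, (L ^ (k - j)) • Ct j (s i) i' - ∑ j ∈ range k, (L ^ (k - j)) • Ct j i i')‖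
      ≤ C * (L / (L - 1) * Real.exp (c / 2)
            + (Nat.factorial 2 : ℝ) / (c / 2) ^ 2 * (1 - Real.exp (-(c / 2 * (L - 1))))⁻¹)
          * (ρ i i' / L ^ k)⁻¹ ^ 2 * Real.exp (-(c / 2 * (L * (ρ i i' / L ^ k)))) := by
  have hL0 : 0 < L := by linarith
  have hd : 0 < ρ i i' / L ^ k := by positivity
  rw [dimock29_deriv_identity]
  refine norm_sum_scales_smul_le (E := E) hL hc (by norm_num) k hd hC
    (fun j => (L ^ j) • (Ct j (s i) i' - Ct j i i')) ?_
  intro j hj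
  rw [pow_sub_mul_div_pow hL0 hj.le]
  exact h28d j hj i i'

/-- **(26) + (28) ⟹ (29), the derivative of the photon propagator everywhere (the diagonal member)**:
`‖(∂^{(k)}G_k)(i,i′)‖ ≤ C·(1 − L^{−2})^{−1}·L^{2k}` for ALL `i, i′` — the printed `O(L^{2k})` at `x = x′`.
[cite: Dimock2004QED3TorusII, §1.2.4 (29) p.6 L60–69] -/
theorem dimock29_deriv_diag (hL : 1 < L) (hc : 0 < c) (hC : 0 ≤ C) (ρ : I → I → ℝ)
    (hρ0 : ∀ i i', 0 ≤ ρ i i') (s : I → I) (Ct : ℕ → I → I → E) (k : ℕ)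
    (h28d : ∀ j < k, ∀ i i', ‖(L ^ j) • (Ct j (s i) i' - Ct j i i')‖ ≤ C * Real.exp (-(c * (ρ i i' / L ^ j))))
    (i i' : I) :
    ‖(L ^ k) • (∑ j ∈ range k, (L ^ (k - j)) • Ct j (s i) i' - ∑ j ∈ range k, (L ^ (k - j)) • Ct j i i')‖
      ≤ C * (1 - (L ^ 2)⁻¹)⁻¹ * (L ^ k) ^ 2 := by
  have hL0 : 0 < L := by linarith
  rw [dimock29_deriv_identity]
  refine norm_sum_scales_smul_diag_le (E := E) hL (by norm_num) k hC
    (fun j => (L ^ j) • (Ct j (s i) i' - Ct j i i')) ?_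
  intro j hj
  refine (h28d j hj i i').trans ?_
  have : Real.exp (-(c * (ρ i i' / L ^ j))) ≤ 1 := Real.exp_le_one_iff.2 (by
    have := hρ0 i i'; have : 0 ≤ c * (ρ i i' / L ^ j) := by positivity
    linarith)
  nlinarith

/-- **(50) + (52) ⟹ (53), the fermion propagator with background field off the diagonal.**  Per-scale kernels
`Γ̃_j = Γ̃_j(A_{L^{k−j}})` with (52) on their own lattice, `‖Γ̃_j(i,i′)‖ ≤ C·e^{−c·ρ(i,i′)∕L^j}` (`j < k`);
`S_k(A;i,i′) = Σ_{j<k} L^{2(k−j)}•Γ̃_j(i,i′)` (50); `ρ(i,i′) > 0`.  Then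
`‖S_k(A;i,i′)‖ ≤ C·K(L,c,2)·(ρ(i,i′)∕L^k)^{−2}·e^{−(c∕2)L·ρ(i,i′)∕L^k}` — the printed
`|S_k(A,x,x′)| ≤ O(1)d(x,x′)^{−2}e^{−O(1)d(x,x′)}`, *"the characteristic short distant singularity `d(x,x′)^{−2}`"*.
[cite: Dimock2004QED3TorusII, §1.3.4 (50)–(53) p.9 L32–60] -/
theorem dimock53 (hL : 1 < L) (hc : 0 < c) (hC : 0 ≤ C) (ρ : I → I → ℝ) (Gt : ℕ → I → I → E)
    (k : ℕ) (h52 : ∀ j < k, ∀ i i', ‖Gt j i i'‖ ≤ C * Real.exp (-(c * (ρ i i' / L ^ j))))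
    {i i' : I} (hρ : 0 < ρ i i') :
    ‖∑ j ∈ range k, (L ^ (2 * (k - j))) • Gt j i i'‖
      ≤ C * (L / (L - 1) * Real.exp (c / 2)
            + (Nat.factorial 2 : ℝ) / (c / 2) ^ 2 * (1 - Real.exp (-(c / 2 * (L - 1))))⁻¹)
          * (ρ i i' / L ^ k)⁻¹ ^ 2 * Real.exp (-(c / 2 * (L * (ρ i i' / L ^ k)))) := by
  have hL0 : 0 < L := by linarith
  have hd : 0 < ρ i i' / L ^ k := by positivity
  refine norm_sum_scales_smul_le (E := E) hL hc (by norm_num) k hd hC (fun j => Gt j i i') ?_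
  intro j hj
  rw [pow_sub_mul_div_pow hL0 hj.le]
  exact h52 j hj i i'

/-- **(50) + (52) ⟹ (53), the fermion propagator everywhere (the diagonal member)**: with (52) for `Γ̃_j` and `ρ ≥ 0`,
`‖S_k(A;i,i′)‖ ≤ C·(1 − L^{−2})^{−1}·L^{2k}` for ALL `i, i′` — the printed `O(L^{2k})` at `x = x′`.
[cite: Dimock2004QED3TorusII, §1.3.4 (53) p.9 L54–58] -/
theorem dimock53_diag (hL : 1 < L) (hc : 0 < c) (hC : 0 ≤ C) (ρ : I → I → ℝ)
    (hρ0 : ∀ i i', 0 ≤ ρ i i') (Gt : ℕ → I → I → E)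
    (k : ℕ) (h52 : ∀ j < k, ∀ i i', ‖Gt j i i'‖ ≤ C * Real.exp (-(c * (ρ i i' / L ^ j)))) (i i' : I) :
    ‖∑ j ∈ range k, (L ^ (2 * (k - j))) • Gt j i i'‖ ≤ C * (1 - (L ^ 2)⁻¹)⁻¹ * (L ^ k) ^ 2 := by
  have hL0 : 0 < L := by linarith
  refine norm_sum_scales_smul_diag_le (E := E) hL (by norm_num) k hC (fun j => Gt j i i') ?_
  intro j hj
  refine (h52 j hj i i').trans ?_
  have : Real.exp (-(c * (ρ i i' / L ^ j))) ≤ 1 := Real.exp_le_one_iff.2 (by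
    have := hρ0 i i'; have : 0 ≤ c * (ρ i i' / L ^ j) := by positivity
    linarith)
  nlinarith

/-! ### The printed quantifier shape: `O(1)`'s chosen from `L` and the `O(1)`'s of (28) ∕ (52) alone -/

/-- **(29) AS PRINTED (value member).**  For `L > 1` and a decay rate `c > 0` there are `O₁, O₂ > 0` such that for EVERY
amplitude `C ≥ 0`, index distance `ρ ≥ 0`, family of per-scale kernels `C̃_j` obeying (28) `‖C̃_j(i,i′)‖ ≤ Ce^{−cρ(i,i′)∕L^j}`,
every number of steps `k` and all sites: `‖G_k(i,i′)‖ ≤ C·O₁·d^{−1}e^{−O₂d}` when `ρ(i,i′) > 0` (`x ≠ x′`, `d = ρ(i,i′)∕L^k`) and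
`‖G_k(i,i′)‖ ≤ C·O₁·L^k` always (`x = x′`), `G_k = Σ_{j<k}L^{k−j}C̃_j` (26).  (`O₁ = K(L,c,1) + (1 − L^{−1})^{−1}`, `O₂ = cL∕2`.)
[cite: Dimock2004QED3TorusII, §1.2.4 (26)–(29) p.6 L46–77] -/
theorem dimock29_value_asPrinted (hL : 1 < L) (hc : 0 < c) :
    ∃ O₁ O₂ : ℝ, 0 < O₁ ∧ 0 < O₂ ∧
      ∀ (C : ℝ), 0 ≤ C → ∀ (ρ : I → I → ℝ), (∀ i i', 0 ≤ ρ i i') →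
        ∀ (Ct : ℕ → I → I → E) (k : ℕ),
          (∀ j < k, ∀ i i', ‖Ct j i i'‖ ≤ C * Real.exp (-(c * (ρ i i' / L ^ j)))) →
          ∀ i i' : I,
            (0 < ρ i i' → ‖∑ j ∈ range k, (L ^ (k - j)) • Ct j i i'‖
                ≤ C * O₁ * (ρ i i' / L ^ k)⁻¹ * Real.exp (-(O₂ * (ρ i i' / L ^ k)))) ∧
            ‖∑ j ∈ range k, (L ^ (k - j)) • Ct j i i'‖ ≤ C * O₁ * L ^ k := by
  have hL0 : 0 < L := by linarith
  have hK := scaleConst_pos hL hc 1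
  have hD : 0 < (1 - (L ^ 1)⁻¹)⁻¹ := by
    rw [pow_one]; exact inv_pos.2 (by have := inv_lt_one_of_one_lt₀ hL; linarith)
  refine ⟨(L / (L - 1) * Real.exp (c / 2)
        + (Nat.factorial 1 : ℝ) / (c / 2) ^ 1 * (1 - Real.exp (-(c / 2 * (L - 1))))⁻¹) + (1 - (L ^ 1)⁻¹)⁻¹,
      c / 2 * L, by linarith, by positivity, ?_⟩
  intro C hC ρ hρ0 Ct k h28 i i'
  refine ⟨fun hρ => ?_, ?_⟩
  · have h := dimock29_value (E := E) hL hc hC ρ Ct k h28 hρ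
    have hd : 0 < ρ i i' / L ^ k := by positivity
    have e : Real.exp (-(c / 2 * (L * (ρ i i' / L ^ k)))) = Real.exp (-(c / 2 * L * (ρ i i' / L ^ k))) := by
      rw [mul_assoc]
    rw [pow_one ((ρ i i' / L ^ k)⁻¹), e] at h
    refine h.trans ?_
    exact mul_le_mul_of_nonneg_right (mul_le_mul_of_nonneg_right
      (mul_le_mul_of_nonneg_left (le_add_of_nonneg_right hD.le) hC) (by positivity)) (by positivity)
  · have h := dimock29_value_diag (E := E) hL hc hC ρ hρ0 Ct k h28 i i'
    rw [pow_one (L ^ k)] at h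
    refine h.trans ?_
    exact mul_le_mul_of_nonneg_right (mul_le_mul_of_nonneg_left (le_add_of_nonneg_left hK.le) hC)
      (by positivity)

/-- **(29) AS PRINTED (derivative member).**  For `L > 1`, `c > 0` there are `O₁, O₂ > 0` such that for every `C ≥ 0`,
`ρ ≥ 0`, shift `s`, kernels with `‖(∂^{(j)}C̃_j)(i,i′)‖ ≤ Ce^{−cρ(i,i′)∕L^j}` (`j < k`), every `k` and all sites:
`‖(∂^{(k)}G_k)(i,i′)‖ ≤ C·O₁·d^{−2}e^{−O₂d}` when `ρ(i,i′) > 0` and `≤ C·O₁·L^{2k}` always.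
(`O₁ = K(L,c,2) + (1 − L^{−2})^{−1}`, `O₂ = cL∕2`.) [cite: Dimock2004QED3TorusII, §1.2.4 (29) p.6 L60–77] -/
theorem dimock29_deriv_asPrinted (hL : 1 < L) (hc : 0 < c) :
    ∃ O₁ O₂ : ℝ, 0 < O₁ ∧ 0 < O₂ ∧
      ∀ (C : ℝ), 0 ≤ C → ∀ (ρ : I → I → ℝ), (∀ i i', 0 ≤ ρ i i') →
        ∀ (s : I → I) (Ct : ℕ → I → I → E) (k : ℕ),
          (∀ j < k, ∀ i i', ‖(L ^ j) • (Ct j (s i) i' - Ct j i i')‖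
              ≤ C * Real.exp (-(c * (ρ i i' / L ^ j)))) →
          ∀ i i' : I,
            (0 < ρ i i' →
              ‖(L ^ k) • (∑ j ∈ range k, (L ^ (k - j)) • Ct j (s i) i'
                  - ∑ j ∈ range k, (L ^ (k - j)) • Ct j i i')‖
                ≤ C * O₁ * (ρ i i' / L ^ k)⁻¹ ^ 2 * Real.exp (-(O₂ * (ρ i i' / L ^ k)))) ∧
            ‖(L ^ k) • (∑ j ∈ range k, (L ^ (k - j)) • Ct j (s i) i'
                - ∑ j ∈ range k, (L ^ (k - j)) • Ct j i i')‖ ≤ C * O₁ * (L ^ k) ^ 2 := by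
  have hL0 : 0 < L := by linarith
  have hK := scaleConst_pos hL hc 2
  have hD : 0 < (1 - (L ^ 2)⁻¹)⁻¹ :=
    inv_pos.2 (by have := inv_lt_one_of_one_lt₀ (one_lt_pow₀ hL two_ne_zero); linarith)
  refine ⟨(L / (L - 1) * Real.exp (c / 2)
        + (Nat.factorial 2 : ℝ) / (c / 2) ^ 2 * (1 - Real.exp (-(c / 2 * (L - 1))))⁻¹) + (1 - (L ^ 2)⁻¹)⁻¹,
      c / 2 * L, by linarith, by positivity, ?_⟩
  intro C hC ρ hρ0 s Ct k h28d i i'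
  refine ⟨fun hρ => ?_, ?_⟩
  · have h := dimock29_deriv (E := E) hL hc hC ρ s Ct k h28d hρ
    have hd : 0 < ρ i i' / L ^ k := by positivity
    have e : Real.exp (-(c / 2 * (L * (ρ i i' / L ^ k)))) = Real.exp (-(c / 2 * L * (ρ i i' / L ^ k))) := by
      rw [mul_assoc]
    rw [e] at h
    refine h.trans ?_
    exact mul_le_mul_of_nonneg_right (mul_le_mul_of_nonneg_right
      (mul_le_mul_of_nonneg_left (le_add_of_nonneg_right hD.le) hC) (by positivity)) (by positivity)
  · have h := dimock29_deriv_diag (E := E) hL hc hC ρ hρ0 s Ct k h28d i i'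
    refine h.trans ?_
    exact mul_le_mul_of_nonneg_right (mul_le_mul_of_nonneg_left (le_add_of_nonneg_left hK.le) hC)
      (by positivity)

/-- **(53) AS PRINTED.**  For `L > 1`, `c > 0` there are `O₁, O₂ > 0` such that for every `C ≥ 0`, `ρ ≥ 0`, kernels
`Γ̃_j` with (52) `‖Γ̃_j(i,i′)‖ ≤ Ce^{−cρ(i,i′)∕L^j}` (`j < k`), every `k` and all sites: `‖S_k(A;i,i′)‖ ≤ C·O₁·d^{−2}e^{−O₂d}`
when `ρ(i,i′) > 0` (`x ≠ x′`) and `≤ C·O₁·L^{2k}` always (`x = x′`), `S_k = Σ_{j<k}L^{2(k−j)}Γ̃_j` (50).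
(`O₁ = K(L,c,2) + (1 − L^{−2})^{−1}`, `O₂ = cL∕2`.) [cite: Dimock2004QED3TorusII, §1.3.4 (50)–(53) p.9 L32–60] -/
theorem dimock53_asPrinted (hL : 1 < L) (hc : 0 < c) :
    ∃ O₁ O₂ : ℝ, 0 < O₁ ∧ 0 < O₂ ∧
      ∀ (C : ℝ), 0 ≤ C → ∀ (ρ : I → I → ℝ), (∀ i i', 0 ≤ ρ i i') →
        ∀ (Gt : ℕ → I → I → E) (k : ℕ),
          (∀ j < k, ∀ i i', ‖Gt j i i'‖ ≤ C * Real.exp (-(c * (ρ i i' / L ^ j)))) →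
          ∀ i i' : I,
            (0 < ρ i i' → ‖∑ j ∈ range k, (L ^ (2 * (k - j))) • Gt j i i'‖
                ≤ C * O₁ * (ρ i i' / L ^ k)⁻¹ ^ 2 * Real.exp (-(O₂ * (ρ i i' / L ^ k)))) ∧
            ‖∑ j ∈ range k, (L ^ (2 * (k - j))) • Gt j i i'‖ ≤ C * O₁ * (L ^ k) ^ 2 := by
  have hL0 : 0 < L := by linarith
  have hK := scaleConst_pos hL hc 2
  have hD : 0 < (1 - (L ^ 2)⁻¹)⁻¹ :=
    inv_pos.2 (by have := inv_lt_one_of_one_lt₀ (one_lt_pow₀ hL two_ne_zero); linarith)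
  refine ⟨(L / (L - 1) * Real.exp (c / 2)
        + (Nat.factorial 2 : ℝ) / (c / 2) ^ 2 * (1 - Real.exp (-(c / 2 * (L - 1))))⁻¹) + (1 - (L ^ 2)⁻¹)⁻¹,
      c / 2 * L, by linarith, by positivity, ?_⟩
  intro C hC ρ hρ0 Gt k h52 i i'
  refine ⟨fun hρ => ?_, ?_⟩
  · have h := dimock53 (E := E) hL hc hC ρ Gt k h52 hρ
    have hd : 0 < ρ i i' / L ^ k := by positivity
    have e : Real.exp (-(c / 2 * (L * (ρ i i' / L ^ k)))) = Real.exp (-(c / 2 * L * (ρ i i' / L ^ k))) := by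
      rw [mul_assoc]
    rw [e] at h
    refine h.trans ?_
    exact mul_le_mul_of_nonneg_right (mul_le_mul_of_nonneg_right
      (mul_le_mul_of_nonneg_left (le_add_of_nonneg_right hD.le) hC) (by positivity)) (by positivity)
  · have h := dimock53_diag (E := E) hL hc hC ρ hρ0 Gt k h52 i i'
    refine h.trans ?_
    exact mul_le_mul_of_nonneg_right (mul_le_mul_of_nonneg_left (le_add_of_nonneg_left hK.le) hC)
      (by positivity)

end Dimock

/-! ## §3 (27) ∕ (51) with (28) ∕ (52): the composite kernels `H_jC_jH_j^T`, `H_jΓ_jH_j^T` and their decay -/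

section Chain

variable {R : Type*} [SeminormedRing R]
variable {I Y : Type*} [Fintype Y]

/-- **The composite kernel (27) `C̃_j = H_jC_jH_j^T` (and (51) `Γ̃_j = H_jΓ_jH_j^T`, and `∂C̃_j = (∂H_j)C_jH_j^T`) decays
like its factors.**  Kernels `A(x,y)`, `B(y,y′)`, `D(x′,y′)` over unit-lattice points `y = ι(y)` (`Y` finite), values in a
(semi)normed ring, with `‖A(x,ιy)‖ ≤ C_Ae^{−cρ(x,ιy)}`, `‖B(ιy,ιy′)‖ ≤ C_Be^{−cρ(ιy,ιy′)}`, `‖D(x′,ιy′)‖ ≤ C_De^{−cρ(x′,ιy′)}`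
(the first two lines of (28) ∕ (52): `A ∈ {H_j, ∂H_j}`, `B ∈ {C_j, Γ_j}`, `D = H_j` via `H^T(y′,x′) = H(x′,y′)`), an index
distance `ρ ≥ 0`, symmetric, with the triangle inequality, and the one-point lattice sum `Σ_y e^{−(c∕2)ρ(u,ιy)} ≤ K₀`
uniform in `u`.  Then `‖Σ_{y,y′} A(x,ιy)B(ιy,ιy′)D(x′,ιy′)‖ ≤ C_AC_BC_D·K₀²·e^{−(c∕2)ρ(x,x′)}` — half of the decay pays the
two intermediate sums, half survives (the third line of (28) ∕ (52) from the first two, and the `∂C̃_j` input of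
`dimock29_deriv`). [cite: Dimock2004QED3TorusII, §1.2.4 (27)–(28) p.6 L48–59 and §1.3.4 (51)–(52) p.9 L40–49] -/
theorem chain3_norm_le {ρ : I → I → ℝ} (hρ0 : ∀ a b, 0 ≤ ρ a b) (hsymm : ∀ a b, ρ a b = ρ b a)
    (htri : ∀ a b e, ρ a e ≤ ρ a b + ρ b e) (ι : Y → I) {c K CA CB CD : ℝ} (hc : 0 ≤ c)
    (hCA : 0 ≤ CA) (hCB : 0 ≤ CB) (hCD : 0 ≤ CD)
    (hK : ∀ u : I, ∑ y, Real.exp (-(c / 2 * ρ u (ι y))) ≤ K)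
    (A B D : I → I → R) (x x' : I)
    (hA : ∀ y, ‖A x (ι y)‖ ≤ CA * Real.exp (-(c * ρ x (ι y))))
    (hB : ∀ y y', ‖B (ι y) (ι y')‖ ≤ CB * Real.exp (-(c * ρ (ι y) (ι y'))))
    (hD : ∀ y', ‖D x' (ι y')‖ ≤ CD * Real.exp (-(c * ρ x' (ι y')))) :
    ‖∑ y, ∑ y', A x (ι y) * B (ι y) (ι y') * D x' (ι y')‖
      ≤ CA * CB * CD * K ^ 2 * Real.exp (-(c / 2 * ρ x x')) := by
  have hK0 : 0 ≤ K := (hK x).trans' (sum_nonneg fun y _ => (Real.exp_pos _).le)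
  -- pointwise: ‖A B D‖ ≤ CA CB CD e^{−(c/2)ρ(x,x′)} e^{−(c/2)ρ(x,y)} e^{−(c/2)ρ(y,y′)}
  have hpt : ∀ y y', ‖A x (ι y) * B (ι y) (ι y') * D x' (ι y')‖
      ≤ CA * CB * CD * Real.exp (-(c / 2 * ρ x x')) *
          (Real.exp (-(c / 2 * ρ x (ι y))) * Real.exp (-(c / 2 * ρ (ι y) (ι y')))) := by
    intro y y'
    have h1 : ‖A x (ι y) * B (ι y) (ι y') * D x' (ι y')‖
        ≤ (CA * Real.exp (-(c * ρ x (ι y)))) * (CB * Real.exp (-(c * ρ (ι y) (ι y'))))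
            * (CD * Real.exp (-(c * ρ x' (ι y')))) := by
      calc ‖A x (ι y) * B (ι y) (ι y') * D x' (ι y')‖
          ≤ ‖A x (ι y) * B (ι y) (ι y')‖ * ‖D x' (ι y')‖ := norm_mul_le _ _
        _ ≤ (‖A x (ι y)‖ * ‖B (ι y) (ι y')‖) * ‖D x' (ι y')‖ :=
            mul_le_mul_of_nonneg_right (norm_mul_le _ _) (norm_nonneg _)
        _ ≤ _ :=
            mul_le_mul (mul_le_mul (hA y) (hB y y') (norm_nonneg _) (mul_nonneg hCA (Real.exp_pos _).le))
              (hD y') (norm_nonneg _)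
              (mul_nonneg (mul_nonneg hCA (Real.exp_pos _).le) (mul_nonneg hCB (Real.exp_pos _).le))
    -- exponent bookkeeping
    have htri3 : ρ x x' ≤ ρ x (ι y) + ρ (ι y) (ι y') + ρ x' (ι y') := by
      have h2 := htri x (ι y) x'
      have h3 := htri (ι y) (ι y') x'
      rw [hsymm (ι y') x'] at h3
      linarith
    have hexp : Real.exp (-(c * ρ x (ι y))) * Real.exp (-(c * ρ (ι y) (ι y'))) * Real.exp (-(c * ρ x' (ι y')))
        ≤ Real.exp (-(c / 2 * ρ x x')) *
          (Real.exp (-(c / 2 * ρ x (ι y))) * Real.exp (-(c / 2 * ρ (ι y) (ι y')))) := by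
      rw [← Real.exp_add, ← Real.exp_add, ← Real.exp_add, ← Real.exp_add]
      apply Real.exp_le_exp.2
      have := hρ0 x' (ι y'); have := hρ0 x (ι y); have := hρ0 (ι y) (ι y')
      nlinarith
    calc ‖A x (ι y) * B (ι y) (ι y') * D x' (ι y')‖ ≤ _ := h1
      _ = CA * CB * CD * (Real.exp (-(c * ρ x (ι y))) * Real.exp (-(c * ρ (ι y) (ι y')))
            * Real.exp (-(c * ρ x' (ι y')))) := by ring
      _ ≤ CA * CB * CD * (Real.exp (-(c / 2 * ρ x x')) *
          (Real.exp (-(c / 2 * ρ x (ι y))) * Real.exp (-(c / 2 * ρ (ι y) (ι y'))))) :=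
          mul_le_mul_of_nonneg_left hexp (by positivity)
      _ = _ := by ring
  -- the double sum of the exponential weights ≤ K²
  have hsum : ∑ y, ∑ y', Real.exp (-(c / 2 * ρ x (ι y))) * Real.exp (-(c / 2 * ρ (ι y) (ι y'))) ≤ K ^ 2 := by
    calc ∑ y, ∑ y', Real.exp (-(c / 2 * ρ x (ι y))) * Real.exp (-(c / 2 * ρ (ι y) (ι y')))
        = ∑ y, Real.exp (-(c / 2 * ρ x (ι y))) * ∑ y', Real.exp (-(c / 2 * ρ (ι y) (ι y'))) := by
          refine sum_congr rfl fun y _ => ?_; rw [mul_sum]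
      _ ≤ ∑ y, Real.exp (-(c / 2 * ρ x (ι y))) * K :=
          sum_le_sum fun y _ => mul_le_mul_of_nonneg_left (hK (ι y)) (Real.exp_pos _).le
      _ = (∑ y, Real.exp (-(c / 2 * ρ x (ι y)))) * K := by rw [sum_mul]
      _ ≤ K * K := mul_le_mul_of_nonneg_right (hK x) hK0
      _ = K ^ 2 := (sq K).symm
  calc ‖∑ y, ∑ y', A x (ι y) * B (ι y) (ι y') * D x' (ι y')‖
      ≤ ∑ y, ‖∑ y', A x (ι y) * B (ι y) (ι y') * D x' (ι y')‖ := norm_sum_le _ _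
    _ ≤ ∑ y, ∑ y', ‖A x (ι y) * B (ι y) (ι y') * D x' (ι y')‖ := sum_le_sum fun y _ => norm_sum_le _ _
    _ ≤ ∑ y, ∑ y', CA * CB * CD * Real.exp (-(c / 2 * ρ x x')) *
          (Real.exp (-(c / 2 * ρ x (ι y))) * Real.exp (-(c / 2 * ρ (ι y) (ι y')))) :=
        sum_le_sum fun y _ => sum_le_sum fun y' _ => hpt y y'
    _ = CA * CB * CD * Real.exp (-(c / 2 * ρ x x')) *
          ∑ y, ∑ y', Real.exp (-(c / 2 * ρ x (ι y))) * Real.exp (-(c / 2 * ρ (ι y) (ι y'))) := by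
        rw [mul_sum]; refine sum_congr rfl fun y _ => ?_; rw [mul_sum]
    _ ≤ CA * CB * CD * Real.exp (-(c / 2 * ρ x x')) * K ^ 2 :=
        mul_le_mul_of_nonneg_left hsum (by positivity)
    _ = _ := by ring

variable [NormedAlgebra ℝ R]

/-- **`∂C̃_j = (∂H_j)C_jH_j^T`**: the `T^{−j}` forward difference quotient `L^j(f(s x) − f(x))` of the composite kernel
(27) in its first argument is the composite kernel with `∂^{(j)}H_j` in the first slot (finite sums; values in a normed
`ℝ`-algebra). [cite: Dimock2004QED3TorusII, §1.2.4 (27)–(29) p.6 L48–69 (the `|∂H_j|` member of (28) feeding `|∂G_k|`)] -/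
theorem smul_chain3_sub (L : ℝ) (j : ℕ) (ι : Y → I) (A B D : I → I → R) (s : I → I) (x x' : I) :
    (L ^ j) • (∑ y, ∑ y', A (s x) (ι y) * B (ι y) (ι y') * D x' (ι y')
        - ∑ y, ∑ y', A x (ι y) * B (ι y) (ι y') * D x' (ι y'))
      = ∑ y, ∑ y', ((L ^ j) • (A (s x) (ι y) - A x (ι y))) * B (ι y) (ι y') * D x' (ι y') := by
  rw [← sum_sub_distrib, smul_sum]
  refine sum_congr rfl fun y _ => ?_
  rw [← sum_sub_distrib, smul_sum]
  refine sum_congr rfl fun y' _ => ?_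
  rw [← sub_mul, ← sub_mul, smul_mul_assoc, smul_mul_assoc]

end Chain

end QED3TorusII

end Literature.MathematicalPhysics.QuantumFieldTheory.Dimock2011to13
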